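import Summits.BirchSwinnertonDyer.BirchSwinnertonDyer.Theorems.PrintCFramAcDescentThreeOrbitTranslates
import Literature.NumberTheory.EllipticCurves.IwasawaSelmerProofs
import HarnessLib

/-!
# The BOTTOM-LAYER DICTIONARY of the orbit span: `proj₀ (Λ_𝒪 · z) = 𝒪_𝔭 · z(𝟙)` — the `Λ`-adic carrier
# of (A𝒪) specialises at the bottom layer EXACTLY onto the carrier of `HasBottomIndexExpZp`
# (cell `bsd-print-cfram`, D-0131 (2) PRINT tier, prover seat p2 gen 3; line «acdescent3» on item
# stmt-BirchSwinnertonDyer-21353, stub (B𝒪) ingredient; `--supports … --as helper`)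

Piece (B𝒪) `AcBottomReadingOrbitAtZpThree` (p570848) reads the `Λ`-level identity of (A𝒪) — stated
over the orbit span `endOrbitSpan 𝒮 D.z ⊆ 𝒮.S` (`Λ = ℤ_p⟦T⟧`-span of the elements projecting to an
`End_K(E_K)`-translate of the family) — at `T = 0` against the bottom index exponent
`D.HasBottomIndexExpZp c`, whose carrier is the `(End_K(E_K) ⊗ ℤ_p)`-span
`padicEndSpan p (κ.layerSubgroup 0) (D.z 0)` of the bottom class inside `∏_k H¹(K, E[p^k])`
(`PadicEndSpan.lean`, D117). This file PROVES that the two carriers MATCH under the bottom projection: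

  `((endOrbitSpan 𝒮 z).map via 𝒮.proj 0) = padicEndSpan p (κ.layerSubgroup 0) (z 0)`

for every relaxed `Λ`-adic datum `𝒮`, every norm-compatible relaxed compact Selmer family `z` (in
particular `D.z`), every elliptic curve over a number field and every `p` (`map_proj_zero_endOrbitSpan_eq`,
`map_proj_zero_endOrbitSpan_eq_of_datum`). Ingredients, all PROVED here or before:
* `proj_zero_X_smul`: `proj₀ (T • s) = 0` — `T` acts as `conj_γ − 1` (`proj_X`) and `conj_γ` is the
  identity on `H¹(Γ_K, ·)` (`layerSubgroup 0 = ⊤`, inner automorphisms act trivially: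
  `conjH1_of_mem_holds`);
* `proj_zero_smul`: `proj₀ (f • s) = f(0) · proj₀ s` (`f = T·g + C f(0)`, `proj_C`);
* `⊆`: span induction — generators project to `φ · z_0 = 1 · (φ · z_0)`, scalars act through `f(0)`
  (`padicPi_mem_padicEndSpan`);
* `⊇`: every generator `c · (φ · z_0)` of the `p`-adic span is `proj₀ (C c • s_φ)` for the element
  `s_φ ∈ endOrbit 𝒮 z` over `φ` supplied by «H-orbit» (`exists_mem_endOrbit_proj_eq_endPi`, p573036 —
  no side hypotheses beyond `z` being a norm-compatible relaxed family).

So in (B𝒪) the index `3^c = [S_rel(K) : tors + 𝒪_𝔭·z(𝟙)]` IS the index of `tors + proj₀(Λ_𝒪·z^ac)`: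
the remaining content of (B𝒪) is exactly (i) Greenberg's Euler characteristic for `X` (tree, by name),
(ii) the RELAXED COMPACT CONTROL `𝒮.S/T·𝒮.S → S_rel(K)` (injective, cokernel of order `#X[T]` on
regime N — the Poitou–Tate input, not in the tree) and (iii) `[𝒮.S/T𝒮.S : image of Λ_𝒪·z^ac] =
3^{ord₃ (char)(0)}` (algebra over `Λ`, given `𝒮.S[T] = 0`). Nothing about any curve's arithmetic is
asserted. «beyond-print theorem»: NO (bookkeeping over the tree's objects).

References: [PerrinRiou1987BSMF] §0 pp. 401–402 (`S_p(K) ← 𝔖_p(K_∞)`: specialisation at the bottom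
layer); [BurungaleKobayashiNakamuraOta2026] §3.2.2, §3.3.1, Thm. 1.8 / Lemma 7.1 (arXiv:2608.06879v1
pp. 18–19, 40: `z(𝟙)` = the bottom specialisation of `z^ac`; shape only); [SerreLocalFields1979]
VII.§5 Prop. 3 (inner automorphisms act trivially); tree `PadicEndSpan.lean` (`padicEndSpan`,
`padicPi_mem_padicEndSpan`, `padicPi_one`), `IwasawaSelmerProofs` (`conjH1_of_mem_holds`), p570848,
p573036.
-/

-- the summit namespace `Summit.BirchSwinnertonDyer.BirchSwinnertonDyer` repeats the problem name by design (D-0017)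
set_option linter.dupNamespace false

noncomputable section

open scoped Classical

open WeierstrassCurve NumberField IsDedekindDomain Field PowerSeries
  Literature.NumberTheory.GaloisRepresentations
  Literature.NumberTheory.EllipticCurves
  Literature.NumberTheory.EllipticCurves.BurungaleKobayashiNakamuraOta2026
  Summit.BirchSwinnertonDyer.BirchSwinnertonDyer.Theorems.PrintCFram.AcDescentThreeSplit

namespace Summit.BirchSwinnertonDyer.BirchSwinnertonDyer.Theorems.PrintCFram.AcDescentThreeOrbit

section Bottom

variable {K : Type} [Field K] [NumberField K] {p : ℕ} [Fact p.Prime]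
  {V : WeierstrassCurve K} {κ : ZpExtension K p} {γ : absoluteGaloisGroup K}
  {𝔭 : HeightOneSpectrum (𝓞 K)}

/-! ## §1 The bottom projection kills `T` and sees only constant coefficients -/

omit [NumberField K] in
/-- **Conjugation is trivial on the bottom layer**: `conjPi γ = id` on `∏_k H¹(Γ_K, E[p^k])`
(`κ.layerSubgroup 0 = ⊤`; inner automorphisms act trivially on `H¹`, `conjH1_of_mem_holds`).
[cite: SerreLocalFields1979, VII.§5 Prop. 3 (inner automorphisms act trivially on cohomology)] -/
theorem conjPi_layerSubgroup_zero (σ : absoluteGaloisGroup K)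
    (x : Π k : ℕ, V.torsionH1Over ((p : ℤ) ^ k) (κ.layerSubgroup 0)) :
    V.conjPi p (κ.layerSubgroup 0) σ x = x := by
  have hσ : σ ∈ κ.layerSubgroup 0 := by rw [ZpExtension.layerSubgroup_zero]; trivial
  funext k
  change Literature.NumberTheory.EllipticCurves.conjH1 (κ.layerSubgroup 0)
    (geomTorsion V ((p : ℤ) ^ k)) σ (x k) = x k
  rw [Literature.NumberTheory.EllipticCurves.conjH1_of_mem_holds (κ.layerSubgroup 0)
    (geomTorsion V ((p : ℤ) ^ k)) hσ, AddMonoidHom.id_apply]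

/-- **`proj₀ (T • s) = 0`**: `T` acts as `conj_γ − 1` (`proj_X`) and `conj_γ` is the identity on the
bottom layer. [cite: PerrinRiou1987BSMF, §0 pp. 401–402 (the Λ-action on 𝔖_p through γ − 1)] -/
theorem proj_zero_X_smul (𝒮 : LambdaAdicRelaxedSelmerData V κ γ 𝔭) (s : 𝒮.S) :
    𝒮.proj 0 ((PowerSeries.X : IwasawaAlgebra p) • s) = 0 := by
  rw [𝒮.proj_X, conjPi_layerSubgroup_zero, sub_self]

/-- **`proj₀ (f • s) = f(0) · proj₀ s`**: split `f = T·g + C f(0)` (`PowerSeries.eq_X_mul_shift_add_const`);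
the `T`-part dies at the bottom (`proj_zero_X_smul`), constants act through `padicPi` (`proj_C`).
[cite: PerrinRiou1987BSMF, §0 pp. 401–402 (specialisation of 𝔖_p(K_∞) at the bottom layer)] -/
theorem proj_zero_smul (𝒮 : LambdaAdicRelaxedSelmerData V κ γ 𝔭) (f : IwasawaAlgebra p) (s : 𝒮.S) :
    𝒮.proj 0 (f • s) = V.padicPi p (κ.layerSubgroup 0) (PowerSeries.constantCoeff f) (𝒮.proj 0 s) := by
  conv_lhs => rw [PowerSeries.eq_X_mul_shift_add_const f]
  rw [add_smul, map_add, mul_smul, proj_zero_X_smul, zero_add, 𝒮.proj_C]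

/-! ## §2 `proj₀ (Λ_𝒪 · z) ⊆ 𝒪_𝔭 · z_0` -/

/-- **`proj₀` maps the orbit span INTO the `p`-adic `End`-span of the bottom class**: generators
project to `φ · z_0 = 1 · (φ · z_0)`, and `Λ`-scalars act at the bottom through their constant
coefficient (`proj_zero_smul`, `padicPi_mem_padicEndSpan`). [cite: BurungaleKobayashiNakamuraOta2026, §3.3.1 and Lemma 7.1 (arXiv:2608.06879v1 pp. 19, 40) (z(𝟙) = bottom specialisation of z^ac; shape only)] -/
theorem proj_zero_mem_padicEndSpan_of_mem_endOrbitSpan (𝒮 : LambdaAdicRelaxedSelmerData V κ γ 𝔭)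
    {z : Π n k : ℕ, V.torsionH1Over ((p : ℤ) ^ k) (κ.layerSubgroup n)} {s : 𝒮.S}
    (hs : s ∈ endOrbitSpan 𝒮 z) :
    𝒮.proj 0 s ∈ V.padicEndSpan p (κ.layerSubgroup 0) (z 0) := by
  induction hs using Submodule.span_induction with
  | mem s hs =>
    obtain ⟨φ, hφ, hproj⟩ := hs
    rw [hproj 0]
    unfold padicEndSpan
    exact AddSubgroup.subset_closure ⟨φ, hφ, 1, (V.padicPi_one p _ _).symm⟩
  | zero => rw [map_zero]; exact zero_mem _
  | add s t _ _ hs ht => rw [map_add]; exact add_mem hs ht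
  | smul f s _ hs =>
    rw [proj_zero_smul]
    exact V.padicPi_mem_padicEndSpan p _ _ _ hs

/-! ## §3 `𝒪_𝔭 · z_0 ⊆ proj₀ (Λ_𝒪 · z)` — via «H-orbit» -/

variable [V.IsElliptic]

/-- **Every generator `c · (φ · z_0)` of the `p`-adic `End`-span is the bottom projection of an
element of the orbit span**, namely of `C c • s_φ` with `s_φ ∈ endOrbit 𝒮 z` over `φ` («H-orbit»,
`exists_mem_endOrbit_proj_eq_endPi`). [cite: BurungaleKobayashiNakamuraOta2026, §3.3.1 (arXiv:2608.06879v1 p. 19) (shape only)] -/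
theorem exists_mem_endOrbitSpan_proj_zero_eq_of_mem_padicEndSpan
    (𝒮 : LambdaAdicRelaxedSelmerData V κ γ 𝔭)
    {z : Π n k : ℕ, V.torsionH1Over ((p : ℤ) ^ k) (κ.layerSubgroup n)}
    (hmem : ∀ n, z n ∈ V.relaxedCompactSelmerOver (κ.layerSubgroup n) p {𝔭})
    (hnorm : ∀ n, V.resPi p (κ.layerSubgroup_antitone (Nat.le_succ n)) (z n) =
      ∑ i ∈ Finset.range p, V.conjPi p (κ.layerSubgroup (n + 1)) (γ ^ (p ^ n * i)) (z (n + 1)))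
    {y : Π k : ℕ, V.torsionH1Over ((p : ℤ) ^ k) (κ.layerSubgroup 0)}
    (hy : y ∈ V.padicEndSpan p (κ.layerSubgroup 0) (z 0)) :
    ∃ s ∈ endOrbitSpan 𝒮 z, 𝒮.proj 0 s = y := by
  unfold padicEndSpan at hy
  induction hy using AddSubgroup.closure_induction with
  | mem y hy =>
    obtain ⟨φ, hφ, c, rfl⟩ := hy
    obtain ⟨s, hs, hproj⟩ := exists_mem_endOrbit_proj_eq_endPi 𝒮 hmem hnorm hφ
    refine ⟨PowerSeries.C c • s, Submodule.smul_mem _ _ (Submodule.subset_span hs), ?_⟩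
    rw [𝒮.proj_C, hproj 0]
  | zero => exact ⟨0, zero_mem _, map_zero _⟩
  | add a b _ _ ha hb =>
    obtain ⟨s, hs, rfl⟩ := ha
    obtain ⟨t, ht, rfl⟩ := hb
    exact ⟨s + t, add_mem hs ht, map_add _ _ _⟩
  | neg a _ ha =>
    obtain ⟨s, hs, rfl⟩ := ha
    exact ⟨-s, neg_mem hs, map_neg _ _⟩

/-! ## §4 The dictionary -/

/-- **THE BOTTOM DICTIONARY: `proj₀ (Λ_𝒪 · z) = 𝒪_𝔭 · z_0`.** For every relaxed `Λ`-adic datum `𝒮`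
and every norm-compatible relaxed compact Selmer family `z`, the image of the orbit span
`endOrbitSpan 𝒮 z` under the bottom projection `𝒮.proj 0` is EXACTLY the `(End_K(E_K) ⊗ ℤ_p)`-span
`padicEndSpan p (κ.layerSubgroup 0) (z 0)` of the bottom class — the carrier of `HasBottomIndexExpZp`.
[cite: PerrinRiou1987BSMF, §0 pp. 401–402 (S_p(K) ← 𝔖_p(K_∞))]
[cite: BurungaleKobayashiNakamuraOta2026, §3.3.1 and Lemma 7.1 (arXiv:2608.06879v1 pp. 19, 40) (claim; preprint; shape only)] -/
theorem map_proj_zero_endOrbitSpan_eq (𝒮 : LambdaAdicRelaxedSelmerData V κ γ 𝔭)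
    {z : Π n k : ℕ, V.torsionH1Over ((p : ℤ) ^ k) (κ.layerSubgroup n)}
    (hmem : ∀ n, z n ∈ V.relaxedCompactSelmerOver (κ.layerSubgroup n) p {𝔭})
    (hnorm : ∀ n, V.resPi p (κ.layerSubgroup_antitone (Nat.le_succ n)) (z n) =
      ∑ i ∈ Finset.range p, V.conjPi p (κ.layerSubgroup (n + 1)) (γ ^ (p ^ n * i)) (z (n + 1))) :
    (endOrbitSpan 𝒮 z).toAddSubgroup.map (𝒮.proj 0) = V.padicEndSpan p (κ.layerSubgroup 0) (z 0) := by
  ext y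
  constructor
  · rintro ⟨s, hs, rfl⟩
    exact proj_zero_mem_padicEndSpan_of_mem_endOrbitSpan 𝒮 hs
  · intro hy
    obtain ⟨s, hs, rfl⟩ := exists_mem_endOrbitSpan_proj_zero_eq_of_mem_padicEndSpan 𝒮 hmem hnorm hy
    exact ⟨s, hs, rfl⟩

/-- **The bottom dictionary for an elliptic-unit datum**: `proj₀ (endOrbitSpan 𝒮 D.z) = 𝒪_𝔭 · z(𝟙)`,
the carrier of `D.HasBottomIndexExpZp` (`PadicEndSpan.lean`) — so piece (B𝒪)'s index
`3^c = [S_rel(K) : tors + 𝒪_𝔭 · z(𝟙)]` is the index of `tors + proj₀(Λ_𝒪 · z^ac)`, BY NAME.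
[cite: BurungaleKobayashiNakamuraOta2026, (3.9), Thm. 1.8 / Lemma 7.1 and §1.4 (arXiv:2608.06879v1 pp. 7, 19, 40) (claim; preprint; shape only)] -/
theorem map_proj_zero_endOrbitSpan_eq_of_datum {W : WeierstrassCurve ℚ} [W.IsElliptic]
    [(W.baseChange K).IsElliptic] {ι : PadicAlgCl p ≃+* ℂ} {φ : HeckeCharacter K} {Ω : ℂ}
    {𝓔 : AcDualExpSystem W p K 𝔭 κ ι}
    (𝒮 : LambdaAdicRelaxedSelmerData (W.baseChange K) κ γ 𝔭)
    (D : EllipticUnitClassData W p K 𝔭 κ γ ι φ Ω 𝓔) :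
    (endOrbitSpan 𝒮 D.z).toAddSubgroup.map (𝒮.proj 0) =
      (W.baseChange K).padicEndSpan p (κ.layerSubgroup 0) (D.z 0) :=
  map_proj_zero_endOrbitSpan_eq 𝒮 D.z_mem D.z_norm

end Bottom

end Summit.BirchSwinnertonDyer.BirchSwinnertonDyer.Theorems.PrintCFram.AcDescentThreeOrbit

end
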